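import Mathlib.Topology.Algebra.Category.ProfiniteGrp.Completion
import Literature.AnabelianGeometry.AbsoluteAnabelian.LocalReciprocityCofinal
import HarnessLib

/-!
# `(K^×)^∧ ≅ G_K^{ab}` extending a GIVEN reciprocity map

[AbsAnab] §1.2 p. 9 (S. Mochizuki, *The Absolute Anabelian Geometry of Hyperbolic Curves* (2004),
kurims manuscript `paper:url-e8f118cc205e`): «by local class field theory … we have a natural isomorphism
`(K^×)^∧ ≅ G^{ab}_K`».  PROOF-ONLY generalisation (abc-iut-L4-d1 gen 4, row «Cor110ii-PRIME») of this seat's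
gen-0 `mlf_reciprocity_completion_holds` (`LocalReciprocityCompletionProofs.lean`, which proves the existence of
SOME such isomorphism from SOME reciprocity map): for EVERY homomorphism `θ : Kˣ → G_K^{ab}` with the
printed properties of the reciprocity map (`IsLocalReciprocityMap`: injective, image = image of the Weil
group, units homeomorphically onto the inertia image, uniformisers to Frobenius) the continuous extension
`e := lift θ : (Kˣ)^∧ → G_K^{ab}` to the profinite completion is a topological isomorphism with
`e ∘ η = θ` — needed to attach the completed isomorphism to THE canonical reciprocity map of the tree
(`isLocalReciprocityMap_levelTheta`), so that the isomorphisms `H¹(G_k, μ_Ẑ(G_k)) ≃ G_k^{ab}` of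
[AbsTopIII] Cor. 1.10 (i)(b) become NATURAL under isomorphisms of absolute Galois groups.  The argument is
VERBATIM the gen-0 one (surjective: compact image containing the dense image of the Weil group; injective:
every finite quotient of `Kˣ` factors through `G_K^{ab}`, `exists_isOpen_comap_le`; compact-to-Hausdorff).
Theorems only.  HONEST FRAMING: classical (Serre, *Local Fields* XIII–XIV); nothing here bears on
[IUTchIII] Cor. 3.12. [cite: MochizukiAbsAnab2004, §1.2 p.9]
-/

noncomputable section

open CategoryTheory Topology Filter
open ValuativeRel Field
open scoped Pointwise

namespace Literature.AnabelianGeometry.AbsoluteAnabelian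

open Literature.NumberTheory.GaloisRepresentations

universe u

/-- **`(Kˣ)^∧ ⥲ₜ G_K^{ab}` extending a given reciprocity map `θ`**: for a non-archimedean local field `K`
of characteristic `0` and ANY `θ : Kˣ → G_K^{ab}` with `IsLocalReciprocityMap K θ`, the continuous
extension of `θ` to the profinite completion of `Kˣ` is a topological group isomorphism `e` with
`e ∘ η = θ` ([AbsAnab] §1.2 p. 9 «natural isomorphism `(K^×)^∧ ≅ G^{ab}_K`»; Serre, *Local Fields*
XIV §6). [cite: MochizukiAbsAnab2004, §1.2 p.9] -/
theorem exists_completion_continuousMulEquiv_extending (K : Type u) [Field K] [ValuativeRel K]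
    [TopologicalSpace K] [IsNonarchimedeanLocalField K] [CharZero K]
    {θ : Kˣ →* absoluteGaloisGroupAbelianization K} (hθ : IsLocalReciprocityMap K θ) :
    ∃ e : ProfiniteGrp.ProfiniteCompletion.completion (GrpCat.of Kˣ) ≃ₜ* absoluteGaloisGroupAbelianization K,
      (e.toMulEquiv.toMonoidHom).comp (ProfiniteGrp.ProfiniteCompletion.eta (GrpCat.of Kˣ)).hom = θ := by
  classical
  haveI htd := totallyDisconnectedSpace_absoluteGaloisGroupAbelianization K
  haveI ht2 : T2Space (absoluteGaloisGroupAbelianization K) := by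
    haveI : IsClosed ((commutator (absoluteGaloisGroup K)).topologicalClosure :
        Set (absoluteGaloisGroup K)) := Subgroup.isClosed_topologicalClosure _
    infer_instance
  let P : ProfiniteGrp.{u} := ProfiniteGrp.of (absoluteGaloisGroupAbelianization K)
  let G : GrpCat.{u} := GrpCat.of Kˣ
  let f : G ⟶ GrpCat.of P := GrpCat.ofHom θ
  let ê := ProfiniteGrp.ProfiniteCompletion.lift f
  -- `ê ∘ η = θ`
  have hê_eta : ∀ x : Kˣ, ê.hom (ProfiniteGrp.ProfiniteCompletion.etaFn G x) = θ x := by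
    intro x
    have h := ConcreteCategory.congr_hom (ProfiniteGrp.ProfiniteCompletion.lift_eta f) x
    simp only [GrpCat.comp_apply] at h
    exact h
  have hcont : Continuous ê.hom := ê.hom.continuous_toFun
  -- SURJECTIVITY: dense compact image
  have hsurj : Function.Surjective ê.hom := by
    have hclosed : IsClosed (Set.range ê.hom) := (isCompact_range hcont).isClosed
    have hd : DenseRange (fun w : WeilGroup K => absGaloisAbProj K (WeilGroup.toAbsGalois K w)) :=
      DenseRange.comp QuotientGroup.mk_surjective.denseRange
        (WeilGroup.denseRange_toAbsGalois_holds K) QuotientGroup.continuous_mk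
    have hsub : Set.range (fun w : WeilGroup K => absGaloisAbProj K (WeilGroup.toAbsGalois K w))
        ⊆ Set.range ê.hom := by
      rintro _ ⟨w, rfl⟩
      have hmem : absGaloisAbProj K (WeilGroup.toAbsGalois K w) ∈ θ.range := by
        rw [hθ.range_eq]
        exact ⟨WeilGroup.toAbsGalois K w, by rw [← WeilGroup.range_toAbsGalois]; exact ⟨w, rfl⟩,
          rfl⟩
      obtain ⟨x, hx⟩ := hmem
      exact ⟨ProfiniteGrp.ProfiniteCompletion.etaFn G x, by rw [hê_eta, hx]⟩
    have hdense : Dense (Set.range ê.hom) := hd.mono hsub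
    exact Set.range_eq_univ.mp (by rw [← hclosed.closure_eq, hdense.closure_eq])
  -- INJECTIVITY: the finite quotients of `Kˣ` factor through `G_K^{ab}`
  have hinj : Function.Injective ê.hom := by
    rw [injective_iff_map_eq_one]
    intro x hx
    apply Subtype.ext
    funext N
    obtain ⟨V, hVopen, hVle⟩ := exists_isOpen_comap_le hθ N.toSubgroup
    let Vn : OpenNormalSubgroup P := { toSubgroup := V, isOpen' := hVopen }
    let N' : FiniteIndexNormalSubgroup G := ProfiniteGrp.ProfiniteCompletion.preimage f Vn
    have hle : N' ≤ N := fun y hy => hVle hy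
    -- the injection `Kˣ / θ⁻¹(V) → G^{ab} / V`
    let j : (ProfiniteGrp.ProfiniteCompletion.diagram G).obj N' →*
        (absoluteGaloisGroupAbelianization K ⧸ V) :=
      QuotientGroup.map N'.toSubgroup V θ le_rfl
    have hjinj : Function.Injective j := by
      rw [injective_iff_map_eq_one]
      intro y hy
      obtain ⟨g, rfl⟩ := QuotientGroup.mk_surjective y
      have h1 : (QuotientGroup.mk (θ g) : absoluteGaloisGroupAbelianization K ⧸ V) = 1 := hy
      rw [QuotientGroup.eq_one_iff] at h1
      exact (QuotientGroup.eq_one_iff g).mpr h1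
    haveI : IsClosed ((V : Subgroup (absoluteGaloisGroupAbelianization K)) :
        Set (absoluteGaloisGroupAbelianization K)) := Subgroup.isClosed_of_isOpen V hVopen
    haveI : DiscreteTopology ((ProfiniteGrp.ProfiniteCompletion.diagram G).obj N') := ⟨rfl⟩
    have key : (fun c : ProfiniteGrp.ProfiniteCompletion.completion G => j (c.1 N')) =
        fun c => (QuotientGroup.mk (ê.hom c) : absoluteGaloisGroupAbelianization K ⧸ V) := by
      refine (ProfiniteGrp.ProfiniteCompletion.denseRange G).equalizer ?_ ?_ ?_
      · have hproj : Continuous (fun c : ProfiniteGrp.ProfiniteCompletion.completion G =>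
            (c.1 N' : (ProfiniteGrp.ProfiniteCompletion.diagram G).obj N')) :=
          ((ProfiniteGrp.limitCone (ProfiniteGrp.ProfiniteCompletion.diagram G)).π.app N').hom.continuous_toFun
        exact continuous_of_discreteTopology.comp hproj
      · exact QuotientGroup.continuous_mk.comp hcont
      · funext g
        change j (QuotientGroup.mk g) = QuotientGroup.mk (ê.hom (ProfiniteGrp.ProfiniteCompletion.etaFn G g))
        rw [hê_eta]
        rfl
    have hN' : x.1 N' = 1 := by
      have h1 := congrFun key x
      simp only [hx, QuotientGroup.mk_one] at h1
      exact hjinj (h1.trans (map_one j).symm)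
    have hcompat := x.2 (homOfLE hle)
    rw [← hcompat, hN', map_one]
    rfl
  -- the topological isomorphism
  let eEquiv : ProfiniteGrp.ProfiniteCompletion.completion G ≃ absoluteGaloisGroupAbelianization K :=
    Equiv.ofBijective ê.hom ⟨hinj, hsurj⟩
  have hsymm : Continuous eEquiv.symm := (hcont.homeoOfEquivCompactToT2 (f := eEquiv)).symm.continuous
  let e : ProfiniteGrp.ProfiniteCompletion.completion G ≃ₜ* absoluteGaloisGroupAbelianization K :=
    { MulEquiv.ofBijective ê.hom.toMonoidHom ⟨hinj, hsurj⟩ with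
      continuous_toFun := hcont
      continuous_invFun := hsymm }
  exact ⟨e, MonoidHom.ext fun x => hê_eta x⟩

end Literature.AnabelianGeometry.AbsoluteAnabelian
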